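import Summits.QuantumFields.BalabanUV.Beta.EriceRemainderEnclosureHistoryJunction

/-!
# RemainderConstTwoShapes — binder (D4) AS CONSUMED («one r < b on one box ]0,γ₀]^{k+1}») versus the JUNCTION shape
# («∀ b > 0 ∃ γ₁ > 0 ∀ γ ∈ ]0,γ₁] ∃ r ∈ [0,b[ …») that the Erice ∕ T⁴ junction files J1–J3, (E1)–(E14) price: the second implies
# the first at every b, NOT conversely; the row's OWN printed chain (R-ε₁) exits in the first shape with NO modulus at zero

Cell `pub-balaban`, β-function sub-cell, BINDER row D4 «RemainderConst leaves for Bałaban's split» (`HOME/BINDER-OWNERS.md`; this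
file by the row OWNER lineage `b2b-balaban-beta-an4`, generation 61), β-FLOW TEAM duty (1) under the coordinator rulings «YM
REDIRECT TOWARDS THE SUMMIT» (FREEZE (0) honoured: def-free module in the lineage's own `Beta/…Remainder…` series; no leaf, no
interface, no folklore-algebra module) and «YM ACCELERATION» (today's coordinator ask `HOME/beta/CMP109-FIDELITY.md` v1.1, read by
the row owner: memo `HOME/b2b-balaban-beta-an4/g61/CMP109-ROW-D4.md` v1.2).  It answers a located imprecision in the OWNER'S OWN
summit-facing words (`HOME/b2b-balaban-beta-an4/SUMMIT-MAP-INPUT-d4.md` §16: «between the printed letters and binder (D4)'s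
`r < b` stand EXACTLY TWO named inputs — (DIAG) … and (OSC) …»; J1 `EriceRemainderEnclosureModulusIff` header: «the n- AND
history-uniform modulus at zero IS binder (D4) itself»): both sentences are exact for the JUNCTION shape and too strong for (D4)
AS CONSUMED.

HONEST FRAMING (BETA-SPEC §0.2, verbatim and binding). *"Discharging BetaPertH makes Bałaban's UV stability UNCONDITIONAL — a
real constructive-QFT result; it is NOT the continuum limit and NOT the Clay problem."*  THIS MODULE DISCHARGES NOTHING: it is
elementary real analysis on the tree's typed shapes `FlowStep.HBeta` (history families β_{k+1}(g₀,…,g_k)), `B12Beta.OneLoopSplit`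
([I] (2.12)–(2.14) p. 268) and `Beta.RemainderChain.RemainderConst`; nothing of Bałaban's (1.22) is asserted, constructed or
instantiated; row D4 class UNCHANGED (critical-path width 0; instance 0∕1; D4 DISCHARGE NO DATE).  NOT BetaPertH, NOT continuum,
NOT Clay.  HONEST DEPENDENCY: continuum YM on T⁴ ⇐ BetaPertH ∧ nine spine estimates (0/9 proved); BetaPertH ⇐ (D1) ∧ (D4) ∧
CAP+tail; G-an2-4 gates asym, D1 and NE2/3/4.

THE TWO SHAPES (spelled inline everywhere; 0 `def`).
* CONSUMED(b): «∃ γ₀ > 0 ∃ r, 0 ≤ r ∧ r < b ∧ RemainderConst S γ₀ r» — what the row-D4 consumers take, AT THE DRIFT'S b: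
  `Beta.DriftRemainder.endpointExistence_of_drift_remainderConst` (:177, `hrem : RemainderConst S γ₀ r`, `hr : r ≤ b`),
  `Beta.ConstRemainderConsumers.flowControl_along_of_driftRemainderConst` (:264, `hrb : r < b`), and the (R10) END
  `Beta.RemainderDecay190.betaPartialSumsLowerH_of_telescope_chainTFac190` (:588, `hε₁ : c.ε₁ * remCoeffL … ≤ b * Real.log L`).
* JUNCTION: «∀ b > 0 ∃ γ₁ > 0 ∀ γ ∈ ]0,γ₁] ∃ r ∈ [0,b[, RemainderConst S γ r» — the conclusion of (E1) `remainderConst_small_ofErice`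
  (p249233) and the left side of J1 `remainderConst_small_iff_uniformModulus` (p274940) ∕ J2 `remainderConst_small_iff_diag_and_osc`
  (p280446); for Markov families ⟺ the n-uniform modulus of β_n at g² = 0, for history families ⟺ (DIAG) ∧ (OSC).

WHAT IS PROVED ([folklore]; 0 sorry; 0 `def`).
* §1 `consumed_of_junction` (JUNCTION ⇒ CONSUMED(b) for every b > 0); `remainderConst_antitone` (boxes shrink with γ);
  **`junction_iff_forall_consumed`** (JUNCTION ⟺ CONSUMED(b) for EVERY b > 0 — the two shapes differ by the quantifier over b ALONE:
  the consumers fix b = the drift's constant);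
  `consumed_of_constBound` — the exit of the row's OWN printed chain R-ε₁ (`Beta.RemainderDecay190.ChainTFac190.abs_beta1_le` :574:
  `RemainderConst S γ₀ (c.ε₁ * remCoeffL …)`, a γ-INDEPENDENT constant) is CONSUMED(b) as soon as that constant is `< b` — the
  smallness condition on the printed constant ε₁ ([II] (2.41) p. 21), NO modulus; `junction_of_af1` — the exit of the
  statement-level route R-264 (`BetaDerivClause.af1_of_atZero` ∕ `B12Beta.af1_of_vanish_lipschitz`: `|β¹_{k+1}| ≤ C·g_k` on
  ]0,γ₀]^{k+1}, the history-uniform reading of [I] p. 264 tl.25–27) IS the JUNCTION shape (r = Cγ → 0).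
* §2 THE WITNESS (family as hypothesis `hβ`, no definition): β_{k+1}(g₀,…,g_k) = 0 if g_k = 0, = r₀ otherwise (r₀ > 0), split with
  β⁰ ≡ 0: `step_remainderConst` (RemainderConst S γ r₀ on EVERY box — exactly R-ε₁'s exit shape, at every γ₀),
  `step_consumed` (CONSUMED(b) for every b > r₀), `step_not_diag` (no diagonal modulus at zero), `step_not_junction` (JUNCTION
  fails: at b = r₀ no box carries an r < r₀).  Hence CONSUMED ⇏ JUNCTION, and R-ε₁'s exit shape cannot be upgraded to the
  junction by shape alone (`constBound_shape_not_junction`).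
* END `twoShapes_census`.
READING (for `HOME/b2b-balaban-beta-an4/SUMMIT-MAP-INPUT-d4.md` §18 and the SPINE row S-D4, sense (α)): (DIAG) ∧ (OSC) — and, for
Erice's Markov family, the n-uniform modulus at g² = 0 — stand between the printed ERICE ∕ T⁴ letters and (D4) VIA THE JUNCTION
(small-box) route, whose exit they characterise EXACTLY (J1∕J2); they are NOT necessary for (D4) as consumed.  The row's own chain
R-ε₁ ([II] Lemma 3 (2.38) → (2.41) → [I] (4.37)∕(5.10) → (5.42); `Chain.abs_beta1_le`, `ChainTFac190.abs_beta1_le`) reaches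
CONSUMED(b) with NEITHER input: its remainder is small because ε₁ is, uniformly in γ ≤ γ₀ — given THE INSTANCE (Bałaban's
one-step objects as Lean terms; 0∕1) and the numerics ε₁K_rem < stepBal.  Class UNCHANGED.
-/

noncomputable section

namespace Summit.QuantumFields.BalabanUV.Beta.RemainderConstTwoShapes

open Literature.MathematicalPhysics.QuantumFieldTheory.Balaban1983to89
open Literature.MathematicalPhysics.QuantumFieldTheory.Balaban1983to89.FlowStep (HBeta)
open Literature.MathematicalPhysics.QuantumFieldTheory.Balaban1983to89.Beta.RemainderChain (RemainderConst)
open Summit.QuantumFields.BalabanUV.Beta.EriceRemainderEnclosureHistoryJunction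
  (histBox_mono diag_of_junction remainderConst_small_iff_diag_and_osc)

variable {β : HBeta}

/-! ## §1 The two shapes: JUNCTION ⇒ CONSUMED(b) for every b; the exits of the two print-side routes -/

/-- **JUNCTION ⇒ CONSUMED(b) for every `b > 0`** (take γ₀ := γ₁ and the r the junction provides there). [folklore] -/
theorem consumed_of_junction (S : B12Beta.OneLoopSplit β)
    (hJ : ∀ b : ℝ, 0 < b → ∃ γ₁ : ℝ, 0 < γ₁ ∧ ∀ γ : ℝ, 0 < γ → γ ≤ γ₁ →
      ∃ r : ℝ, 0 ≤ r ∧ r < b ∧ RemainderConst S γ r)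
    {b : ℝ} (hb : 0 < b) :
    ∃ γ₀ : ℝ, 0 < γ₀ ∧ ∃ r : ℝ, 0 ≤ r ∧ r < b ∧ RemainderConst S γ₀ r := by
  obtain ⟨γ₁, hγ₁, h⟩ := hJ b hb
  exact ⟨γ₁, hγ₁, h γ₁ hγ₁ le_rfl⟩

/-- `RemainderConst` is antitone in the box size: a bound on ]0,γ']^{k+1} is a bound on every smaller box. [folklore] -/
theorem remainderConst_antitone (S : B12Beta.OneLoopSplit β) {γ γ' r : ℝ} (hγ : γ ≤ γ') (h : RemainderConst S γ' r) :
    RemainderConst S γ r := fun k p hp => h k p (histBox_mono hγ hp)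

/-- **JUNCTION ⟺ CONSUMED(b) FOR EVERY b > 0.**  The junction shape is exactly «consumed at every threshold»; (D4) as consumed
is «consumed at ONE threshold», the drift's `b` (`= stepBal`-type constant of rows D1∕CAP).  The gap between the two is therefore
the quantifier over `b` alone. [folklore] -/
theorem junction_iff_forall_consumed (S : B12Beta.OneLoopSplit β) :
    (∀ b : ℝ, 0 < b → ∃ γ₁ : ℝ, 0 < γ₁ ∧ ∀ γ : ℝ, 0 < γ → γ ≤ γ₁ →
        ∃ r : ℝ, 0 ≤ r ∧ r < b ∧ RemainderConst S γ r) ↔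
      ∀ b : ℝ, 0 < b → ∃ γ₀ : ℝ, 0 < γ₀ ∧ ∃ r : ℝ, 0 ≤ r ∧ r < b ∧ RemainderConst S γ₀ r := by
  refine ⟨fun hJ b hb => consumed_of_junction S hJ hb, fun h b hb => ?_⟩
  obtain ⟨γ₀, hγ₀, r, hr0, hrb, hrem⟩ := h b hb
  exact ⟨γ₀, hγ₀, fun γ _ hγle => ⟨r, hr0, hrb, remainderConst_antitone S hγle hrem⟩⟩

/-- **The exit of the row's OWN printed chain R-ε₁ is CONSUMED(b) by a smallness condition, with no modulus.**  If
`RemainderConst S γ₀ r₀` with ONE γ-independent constant `r₀` (the shape of `Beta.RemainderDecay190.ChainTFac190.abs_beta1_le`,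
`r₀ = c.ε₁ * remCoeffL d M c α₂ q.B₃`), then CONSUMED(b) holds for every `b > r₀` — and that inequality is all (hr) asks.
[cite: Balaban1988RG2Cluster, (2.41) p.21; Balaban1987RG1, (5.10) p.293 and (1.22) p.264 — shapes only, nothing asserted] -/
theorem consumed_of_constBound (S : B12Beta.OneLoopSplit β) {γ₀ r₀ b : ℝ} (hγ₀ : 0 < γ₀) (hr₀ : 0 ≤ r₀)
    (hrem : RemainderConst S γ₀ r₀) (hb : r₀ < b) :
    ∃ γ : ℝ, 0 < γ ∧ ∃ r : ℝ, 0 ≤ r ∧ r < b ∧ RemainderConst S γ r :=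
  ⟨γ₀, hγ₀, r₀, hr₀, hb, hrem⟩

/-- **The exit of the statement-level route R-264 IS the JUNCTION shape.**  (AF-1) `|β¹_{k+1}(g₀,…,g_k)| ≤ C·g_k` on
]0,γ₀]^{k+1} (`BetaDerivClause.af1_of_atZero` from the history-uniform reading of [I] p. 264 tl.25–27, or
`B12Beta.af1_of_vanish_lipschitz`) gives, on every box ]0,γ]^{k+1} with `γ ≤ min γ₀ (b ∕ (2(C+1)))`, the remainder constant
`r = C·γ < b`. [cite: Balaban1987RG1, §1 p.264 and (2.12)–(2.14) p.268 — shapes only, nothing asserted] -/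
theorem junction_of_af1 (S : B12Beta.OneLoopSplit β) {C γ₀ : ℝ} (hC : 0 ≤ C) (hγ₀ : 0 < γ₀)
    (hAF1 : ∀ (k : ℕ) (p : Fin (k + 1) → ℝ), p ∈ B12Beta.HistBox γ₀ k → |S.β1 k p| ≤ C * p (Fin.last k)) :
    ∀ b : ℝ, 0 < b → ∃ γ₁ : ℝ, 0 < γ₁ ∧ ∀ γ : ℝ, 0 < γ → γ ≤ γ₁ →
      ∃ r : ℝ, 0 ≤ r ∧ r < b ∧ RemainderConst S γ r := by
  intro b hb
  have hC1 : 0 < C + 1 := by linarith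
  refine ⟨min γ₀ (b / (2 * (C + 1))), lt_min hγ₀ (by positivity), fun γ hγ hγle => ?_⟩
  have hγ₀le : γ ≤ γ₀ := hγle.trans (min_le_left _ _)
  have hγb : γ ≤ b / (2 * (C + 1)) := hγle.trans (min_le_right _ _)
  refine ⟨C * γ, by positivity, ?_, fun k p hp => ?_⟩
  · have h1 : C * γ ≤ C * (b / (2 * (C + 1))) := mul_le_mul_of_nonneg_left hγb hC
    have h2 : C * (b / (2 * (C + 1))) = (C / (C + 1)) * (b / 2) := by
      field_simp
    have h3 : C / (C + 1) < 1 := (div_lt_one hC1).mpr (by linarith)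
    have h4 : (C / (C + 1)) * (b / 2) < 1 * (b / 2) := mul_lt_mul_of_pos_right h3 (by linarith)
    linarith
  · have hpγ₀ : p ∈ B12Beta.HistBox γ₀ k := histBox_mono hγ₀le hp
    exact (hAF1 k p hpγ₀).trans (mul_le_mul_of_nonneg_left (hp (Fin.last k)).2 hC)

/-! ## §2 The witness: CONSUMED ⇏ JUNCTION, and R-ε₁'s exit shape carries no modulus at zero -/

section Step

variable {r₀ : ℝ} (hβ : ∀ (k : ℕ) (p : Fin (k + 1) → ℝ), β k p = if p (Fin.last k) = 0 then 0 else r₀)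
  (S : B12Beta.OneLoopSplit β) (hS0 : ∀ k, S.β0 k = 0)
include hβ hS0

/-- For the step family with one-loop part `0`, the remainder IS the family: `β¹_{k+1}(p) = r₀` whenever `g_k ≠ 0`. [folklore] -/
theorem step_β1_eq (k : ℕ) (p : Fin (k + 1) → ℝ) (hp : p (Fin.last k) ≠ 0) : S.β1 k p = r₀ := by
  have h := S.split k p
  rw [hS0 k, zero_add, hβ k p, if_neg hp] at h
  exact h.symm

/-- **R-ε₁'s exit shape, at every box:** `RemainderConst S γ r₀` for EVERY γ (on a box every last coupling is `> 0`). [folklore] -/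
theorem step_remainderConst (hr₀ : 0 ≤ r₀) (γ : ℝ) : RemainderConst S γ r₀ := fun k p hp => by
  rw [step_β1_eq hβ S hS0 k p (hp (Fin.last k)).1.ne', abs_of_nonneg hr₀]

/-- … hence CONSUMED(b) for every `b > r₀` (with any box size, e.g. γ₀ = 1). [folklore] -/
theorem step_consumed (hr₀ : 0 ≤ r₀) {b : ℝ} (hb : r₀ < b) :
    ∃ γ : ℝ, 0 < γ ∧ ∃ r : ℝ, 0 ≤ r ∧ r < b ∧ RemainderConst S γ r :=
  consumed_of_constBound S one_pos hr₀ (step_remainderConst hβ S hS0 hr₀ 1) hb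

/-- … but NO diagonal modulus at zero: on the constant history `(g,…,g)`, `g > 0`, the remainder is `r₀`, not `≤ r₀∕2`.
[folklore] -/
theorem step_not_diag (hr₀ : 0 < r₀) :
    ¬ (∀ ε : ℝ, 0 < ε → ∃ g₀ : ℝ, 0 < g₀ ∧ ∀ (k : ℕ) (g : ℝ), 0 < g → g ≤ g₀ →
      |S.β1 k (fun _ : Fin (k + 1) => g)| ≤ ε) := by
  intro h
  obtain ⟨g₀, hg₀, hg⟩ := h (r₀ / 2) (half_pos hr₀)
  have h1 := hg 0 g₀ hg₀ le_rfl
  rw [step_β1_eq hβ S hS0 0 _ hg₀.ne', abs_of_pos hr₀] at h1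
  linarith

/-- … and the JUNCTION shape FAILS: at `b = r₀` no box ]0,γ]^{k+1} carries a remainder constant `r < r₀` (evaluate at the constant
history `(γ,…,γ)`).  So CONSUMED ⇏ JUNCTION.  The Markov-letter instance at `r₀ = 1` is the co-owner's (E14) jump family
(`EriceRemainderEnclosureAsPrintedUniform.jump_not_junction`, p288540: `ofErice βE k p = [p_k ≠ 0]·1` for `βE n t = [t ≠ 0]·(−1)`),
there in the service of DOOR 2; the (OSC)-side twin at `r₀ = 1` (diagonal remainder ≡ 0, junction failing through the history) is road
P3's `RemainderExplicitHistoryJunction.junction_threshold_attained` (p287120); different carriers, no shared name. [folklore] -/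
theorem step_not_junction (hr₀ : 0 < r₀) :
    ¬ (∀ b : ℝ, 0 < b → ∃ γ₁ : ℝ, 0 < γ₁ ∧ ∀ γ : ℝ, 0 < γ → γ ≤ γ₁ →
      ∃ r : ℝ, 0 ≤ r ∧ r < b ∧ RemainderConst S γ r) :=
  fun hJ => step_not_diag hβ S hS0 hr₀ fun _ hε => diag_of_junction S hJ hε

end Step

/-- A split with one-loop part `0` EXISTS for the step family (its value at `g_k = 0` is the history-free constant `0`; J2 §0
`exists_split_iff_lastZero`). [folklore] -/
theorem step_split_exists {r₀ : ℝ} (hβ : ∀ (k : ℕ) (p : Fin (k + 1) → ℝ), β k p = if p (Fin.last k) = 0 then 0 else r₀) :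
    ∃ S : B12Beta.OneLoopSplit β, ∀ k, S.β0 k = 0 :=
  ⟨⟨fun _ => 0, β, fun k p => by ring, fun k p hp => by rw [hβ k p, if_pos hp]⟩, fun _ => rfl⟩

/-- **R-ε₁'s EXIT SHAPE CANNOT BE UPGRADED TO THE JUNCTION BY SHAPE ALONE.**  There is a history family with a printed split
such that `RemainderConst S γ r₀` holds on EVERY box (so CONSUMED(b) for every `b > r₀`) while the JUNCTION shape — equivalently
(DIAG) ∧ (OSC) (J2 `remainderConst_small_iff_diag_and_osc`) — fails. [folklore] -/
theorem constBound_shape_not_junction {r₀ : ℝ} (hr₀ : 0 < r₀) :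
    ∃ (β : HBeta) (S : B12Beta.OneLoopSplit β),
      (∀ γ : ℝ, RemainderConst S γ r₀) ∧
      (∀ b : ℝ, r₀ < b → ∃ γ : ℝ, 0 < γ ∧ ∃ r : ℝ, 0 ≤ r ∧ r < b ∧ RemainderConst S γ r) ∧
      ¬ (∀ b : ℝ, 0 < b → ∃ γ₁ : ℝ, 0 < γ₁ ∧ ∀ γ : ℝ, 0 < γ → γ ≤ γ₁ →
          ∃ r : ℝ, 0 ≤ r ∧ r < b ∧ RemainderConst S γ r) ∧
      ¬ ((∀ ε : ℝ, 0 < ε → ∃ g₀ : ℝ, 0 < g₀ ∧ ∀ (k : ℕ) (g : ℝ), 0 < g → g ≤ g₀ →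
            |S.β1 k (fun _ : Fin (k + 1) => g)| ≤ ε) ∧
          (∀ ε : ℝ, 0 < ε → ∃ g₀ : ℝ, 0 < g₀ ∧ ∀ (k : ℕ) (p : Fin (k + 1) → ℝ), p ∈ B12Beta.HistBox g₀ k →
            |β k p - β k (fun _ : Fin (k + 1) => p (Fin.last k))| ≤ ε)) := by
  let β : HBeta := fun k p => if p (Fin.last k) = 0 then 0 else r₀
  have hβ : ∀ (k : ℕ) (p : Fin (k + 1) → ℝ), β k p = if p (Fin.last k) = 0 then 0 else r₀ := fun _ _ => rfl
  obtain ⟨S, hS0⟩ := step_split_exists hβ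
  refine ⟨β, S, step_remainderConst hβ S hS0 hr₀.le, fun b hb => step_consumed hβ S hS0 hr₀.le hb,
    step_not_junction hβ S hS0 hr₀, fun h => ?_⟩
  exact step_not_junction hβ S hS0 hr₀ ((remainderConst_small_iff_diag_and_osc S).mpr h)

/-! ## END -/

/-- **END — THE TWO SHAPES OF THE REMAINDER BINDER.**  (a) JUNCTION ⇒ CONSUMED(b) for every b > 0 (and conversely JUNCTION ⟺ ∀ b, CONSUMED(b): `junction_iff_forall_consumed`); (b) the statement-level
route's exit (AF-1, `|β¹| ≤ C g_k` on ]0,γ₀]^{k+1}) IS the junction shape; (c) a γ-independent constant bound `RemainderConst S γ₀ r₀`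
— the exit shape of the row's own printed chain R-ε₁ (and of road P3's END `RemainderExplicitEnd.exists_remainderConst_of_residualChain`,
whose junction clause above threshold is `RemainderExplicitHistoryJunction.junction_above_of_remainderConst`, p283898) — is CONSUMED(b)
whenever `r₀ < b` (a smallness condition; for the §2 witness, only then), and
(d) by a witness, such a bound on every box does NOT give the junction shape (nor (DIAG) ∧ (OSC)).  READING: the Erice ∕ T⁴ junction
inputs (the n-uniform modulus at g² = 0; (DIAG) ∧ (OSC)) are the EXACT price of the junction route and are NOT necessary for (D4)
as consumed; the row's own chain reaches (D4) as consumed with neither, given the instance and ε₁K_rem < stepBal.  Nothing of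
Bałaban's; class UNCHANGED. [cite: Balaban1987RG1, Thm 2 p.259 (first sentence) and §1 p.264; Balaban1988RG2Cluster, (2.41) p.21 — shapes only, nothing asserted] -/
theorem twoShapes_census :
    (∀ (β : HBeta) (S : B12Beta.OneLoopSplit β),
      (∀ b : ℝ, 0 < b → ∃ γ₁ : ℝ, 0 < γ₁ ∧ ∀ γ : ℝ, 0 < γ → γ ≤ γ₁ →
        ∃ r : ℝ, 0 ≤ r ∧ r < b ∧ RemainderConst S γ r) →
      ∀ b : ℝ, 0 < b → ∃ γ₀ : ℝ, 0 < γ₀ ∧ ∃ r : ℝ, 0 ≤ r ∧ r < b ∧ RemainderConst S γ₀ r) ∧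
    (∀ (β : HBeta) (S : B12Beta.OneLoopSplit β) (C γ₀ : ℝ), 0 ≤ C → 0 < γ₀ →
      (∀ (k : ℕ) (p : Fin (k + 1) → ℝ), p ∈ B12Beta.HistBox γ₀ k → |S.β1 k p| ≤ C * p (Fin.last k)) →
      ∀ b : ℝ, 0 < b → ∃ γ₁ : ℝ, 0 < γ₁ ∧ ∀ γ : ℝ, 0 < γ → γ ≤ γ₁ →
        ∃ r : ℝ, 0 ≤ r ∧ r < b ∧ RemainderConst S γ r) ∧
    (∀ (β : HBeta) (S : B12Beta.OneLoopSplit β) (γ₀ r₀ b : ℝ), 0 < γ₀ → 0 ≤ r₀ → RemainderConst S γ₀ r₀ → r₀ < b →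
      ∃ γ : ℝ, 0 < γ ∧ ∃ r : ℝ, 0 ≤ r ∧ r < b ∧ RemainderConst S γ r) ∧
    (∀ r₀ : ℝ, 0 < r₀ → ∃ (β : HBeta) (S : B12Beta.OneLoopSplit β),
      (∀ γ : ℝ, RemainderConst S γ r₀) ∧
      ¬ (∀ b : ℝ, 0 < b → ∃ γ₁ : ℝ, 0 < γ₁ ∧ ∀ γ : ℝ, 0 < γ → γ ≤ γ₁ →
          ∃ r : ℝ, 0 ≤ r ∧ r < b ∧ RemainderConst S γ r)) :=
  ⟨fun _ S hJ _ hb => consumed_of_junction S hJ hb,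
    fun _ S _ _ hC hγ₀ hAF1 => junction_of_af1 S hC hγ₀ hAF1,
    fun _ S _ _ _ hγ₀ hr₀ hrem hb => consumed_of_constBound S hγ₀ hr₀ hrem hb,
    fun _ hr₀ => by
      obtain ⟨β, S, h1, -, h3, -⟩ := constBound_shape_not_junction hr₀
      exact ⟨β, S, h1, h3⟩⟩

end Summit.QuantumFields.BalabanUV.Beta.RemainderConstTwoShapes

end
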